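import Summits.NavierStokesRegularity.FunctionalMining.StretchingLaminateStepHolds
import Summits.NavierStokesRegularity.FunctionalMining.StretchingLaminateStepRealization
import Summits.NavierStokesRegularity.FunctionalMining.StretchingLaminateRecord
import Summits.NavierStokesRegularity.FunctionalMining.StretchingLaminateRecord2
import Summits.NavierStokesRegularity.FunctionalMining.StretchingLaminateLattice
import Summits.NavierStokesRegularity.FunctionalMining.StretchingLaminateRecord3
import HarnessLib

/-!
# K1-Q1: the laminate realization node is DISCHARGED — unconditional laminate lower bounds for `C⋆`

Cell `pub-nsfunc` (host summit NavierStokesRegularity, topic `FunctionalMining`), prove seat gen 6. **Search for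
candidate a priori estimates; no regularity claim.** Static field inequalities on `T³` and the finite rational tree
calculus; nothing is asserted about Navier–Stokes.

`laminateStep_holds` (part 10) and the dictionary's kernel induction `laminateRealization_of_step` give
**`laminateRealization_holds : LaminateRealization`**: every valid rational div-free lamination tree with `σ > 0` is
realised by smooth divergence-free fields on `T³` up to any relative error. Every kernel certificate of a tree is
therefore an UNCONDITIONAL lower bound for `C⋆ = stretchingSupConst (d := Fin 3)`:
* `d4_le_stretchingSupConst : 69/125 ≤ C⋆` (bank depth-4 tree, `StretchingLaminates`);
* `record_le_stretchingSupConst : 1279/2000 ≤ C⋆` (`StretchingLaminateRecord`),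
  `lattice_le_stretchingSupConst : 6583/10000 ≤ C⋆` (`StretchingLaminateLattice`),
  **`d3g1_le_stretchingSupConst : 6719/10000 ≤ C⋆`** (`StretchingLaminateRecord2`) — the kernel window for K1-Q1
  becomes **`0.6719 ≤ C⋆ ≤ 2/√3 ≈ 1.1547`** (`stretchingSupConst_window_laminate`), up from `(2+√5)/8 ≈ 0.5295`;
* `laminateSupConst_le_stretchingSupConst_holds : C_lam ≤ C⋆` (the realization-free `LaminateDeficit`, `C_lam < 2/√3`, is
  already the tree theorem `Laminate.laminateDeficit_nine_eighths`).
The VALUE of `C⋆` stays open; laminates are a subclass of gradient Young measures, so `C_lam ≤ C⋆` may be strict.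
-/

noncomputable section

namespace Summit.NavierStokesRegularity.FunctionalMining

open Literature.Analysis Literature.Analysis.FunctionSpaces Literature.Analysis.FunctionSpaces.Torus
open Literature.Analysis.FluidPDE Literature.Analysis.FluidPDE.Torus

/-- **The laminate realization node HOLDS** (bank `K1Q1-LAMINATES.md` Lemma 4, in the kernel): composition of
`laminateStep_holds` with the dictionary's tree induction `laminateRealization_of_step`.
Search for candidate a priori estimates; no regularity claim. [ours] -/
theorem laminateRealization_holds : LaminateRealization := laminateRealization_of_step laminateStep_holds

namespace Laminate

/-- **`69/125 ≤ C⋆` unconditionally** (depth-4 optimiser tree `treeD4`). [ours] -/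
theorem d4_le_stretchingSupConst : (69 / 125 : ℝ) ≤ stretchingSupConst (d := Fin 3) :=
  laminate_d4_le_stretchingSupConst laminateRealization_holds

/-- **`1279/2000 ≤ C⋆` unconditionally** (record tree `treeG7`). [ours] -/
theorem record_le_stretchingSupConst : (1279 / 2000 : ℝ) ≤ stretchingSupConst (d := Fin 3) :=
  laminate_record_le_stretchingSupConst laminateRealization_holds

/-- **`6583/10000 ≤ C⋆` unconditionally** (lattice tree `treeK6`). [ours] -/
theorem lattice_le_stretchingSupConst : (6583 / 10000 : ℝ) ≤ stretchingSupConst (d := Fin 3) :=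
  laminate_lattice_le_stretchingSupConst laminateRealization_holds

/-- **`6719/10000 ≤ C⋆` unconditionally** (tree `treeD3G1`) — the cell's best kernel lower bound for K1-Q1. [ours] -/
theorem d3g1_le_stretchingSupConst : (6719 / 10000 : ℝ) ≤ stretchingSupConst (d := Fin 3) :=
  laminate_d3g1_le_stretchingSupConst laminateRealization_holds

/-- **`C_lam ≤ C⋆` unconditionally**: every laminate ratio bound transfers down to fields. [ours] -/
theorem laminateSupConst_le_stretchingSupConst_holds : laminateSupConst ≤ stretchingSupConst (d := Fin 3) :=
  laminateSupConst_le_stretchingSupConst laminateRealization_holds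

-- `LaminateDeficit` (`C_lam < 2/√3`) also follows (`laminateDeficit_of_realization laminateRealization_holds`), but it is
-- already the realization-free tree theorem `Laminate.laminateDeficit_nine_eighths`, so it is not restated here.

/-- **Kernel window for K1-Q1 after the laminate node: `0.6719 ≤ C⋆ ≤ 2/√3`.** [ours] -/
theorem stretchingSupConst_window_laminate :
    (6719 / 10000 : ℝ) ≤ stretchingSupConst (d := Fin 3) ∧ stretchingSupConst (d := Fin 3) ≤ 2 / Real.sqrt 3 :=
  ⟨d3g1_le_stretchingSupConst, stretchingSupConst_le_holder⟩

/-! ## Appended (prove g6, after `StretchingLaminateRecord3` landed): the record rung `0.6752` -/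

/-- **`422/625 = 0.6752 ≤ C⋆` unconditionally** (the bank's 800-split tree `treeE800`, typed record
`StretchingLaminateRecord3`) — the cell's best kernel lower bound for K1-Q1. [ours] -/
theorem e800_le_stretchingSupConst : (422 / 625 : ℝ) ≤ stretchingSupConst (d := Fin 3) :=
  laminate_e800_le_stretchingSupConst laminateRealization_holds

/-- **Kernel window for K1-Q1 after the typed record: `0.6752 ≤ C⋆ ≤ 2/√3`.** [ours] -/
theorem stretchingSupConst_window_e800 :
    (422 / 625 : ℝ) ≤ stretchingSupConst (d := Fin 3) ∧ stretchingSupConst (d := Fin 3) ≤ 2 / Real.sqrt 3 :=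
  ⟨e800_le_stretchingSupConst, stretchingSupConst_le_holder⟩

end Laminate

end Summit.NavierStokesRegularity.FunctionalMining

end
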